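import Literature.NumberTheory.LFunctions.MertensElementary
import Literature.NumberTheory.LFunctions.MontgomeryCoefficientSums
import Mathlib.NumberTheory.PrimeCounting
import HarnessLib

/-!
# Rudnick–Sarnak `n`-level correlations for `ζ`, VII: elementary prime sums for the diagonal

Sibling file of `Literature/NumberTheory/LFunctions/RudnickSarnak.lean` (toward
`Literature.NumberTheory.LFunctions.rudnick_sarnak_unrestricted` at every level). The diagonal
analysis of Rudnick–Sarnak 1996, Lemmas 3.8–3.9 (p. 297–298: "each factor contributes a bounded
quantity unless `a = b = 1`", i.e. higher prime powers and coincident primes are lower order) rests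
on the following elementary sums, recorded with crude explicit constants:

* `Σ_{n ≤ N} Λ(n)/n ≤ 2 log N + 2 log 4` (`RudnickSarnakN.sum_vonMangoldt_div_self_le`; Mertens I
  via `Literature.NumberTheory.LFunctions.MertensBound.sum_log_div_prime_le` and the prime-power
  sum `Σ_{p | d ≤ N} Λ(d)/d ≤ 2 log p/p`);
* the higher prime powers are bounded: `Σ_{n ≤ N, n not prime} Λ(n)/n ≤ 7`
  (`RudnickSarnakN.sum_vonMangoldt_div_self_not_prime_le`);
* `Σ_{2 ≤ k ≤ M} log² k/k² ≤ 3` (`RudnickSarnakN.sum_logSq_div_sq_le`, from the tree's tail bound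
  `Montgomery.sum_Ioc_logSq_div_sq_le`), hence `Σ_{n ≤ N} Λ(n)²/n² ≤ 3`;
* `Σ_{n ≤ N} Λ(n)²/n ≤ log N (2 log N + 2 log 4)`, `Σ_{n ≤ N} Λ(n)⁴/n² ≤ 3 log² N`.

## References

* Z. Rudnick, P. Sarnak, *Zeros of principal `L`-functions and random matrix theory*, Duke Math.
  J. 81 (1996), 269–322, Lemmas 3.8–3.9.
-/

noncomputable section

open Finset
open ArithmeticFunction (vonMangoldt_nonneg vonMangoldt_apply_one vonMangoldt_le_log vonMangoldt_ne_zero_iff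
  vonMangoldt_apply_pow vonMangoldt_apply_prime)
open scoped Real ArithmeticFunction.vonMangoldt

namespace Literature.NumberTheory.LFunctions

namespace RudnickSarnakN

/-! ## Prime powers of a fixed prime -/

/-- For a prime `p` and `e₀ ≥ 1`: `Σ_{d ≤ N, p ∣ d, d = p^e with e ≥ e₀} Λ(d)/d ≤ 2 log p/p^{e₀}`; we
record the two cases used: all prime powers of `p` (`e₀ = 1`), and the proper ones (`e ≥ 2`).
General form: the `d ≤ N` divisible by `p` with `Λ(d) ≠ 0` and satisfying a predicate implied by
`d = p^e, e ≥ e₀` contribute at most `log p Σ_{e ≥ e₀} p^{−e} ≤ 2 log p / p^{e₀}`. [folklore] -/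
theorem sum_vonMangoldt_div_filter_pow_le {p : ℕ} (hp : p.Prime) (N e₀ : ℕ) (he₀ : 1 ≤ e₀)
    (P : ℕ → Prop) [DecidablePred P] (hP : ∀ e, 1 ≤ e → P (p ^ e) → e₀ ≤ e) :
    ∑ d ∈ (Finset.Icc 1 N).filter (fun d ↦ p ∣ d ∧ P d), (Λ d : ℝ) / d ≤ 2 * Real.log p / (p : ℝ) ^ e₀ := by
  classical
  have hp2 : (2 : ℝ) ≤ p := by exact_mod_cast hp.two_le
  have hp0 : (0 : ℝ) < p := by linarith
  have hlogp : 0 ≤ Real.log p := Real.log_nonneg (by linarith)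
  set S := ((Finset.Icc 1 N).filter (fun d ↦ p ∣ d ∧ P d)).filter (fun n ↦ IsPrimePow n) with hS
  have hsplit : ∑ d ∈ (Finset.Icc 1 N).filter (fun d ↦ p ∣ d ∧ P d), (Λ d : ℝ) / d = ∑ d ∈ S, (Λ d : ℝ) / d := by
    rw [hS]
    refine (Finset.sum_filter_of_ne fun n _ hne ↦ ?_).symm
    have : (Λ n : ℝ) ≠ 0 := by intro h0; rw [h0, zero_div] at hne; exact hne rfl
    exact vonMangoldt_ne_zero_iff.mp this
  set K := Nat.log p N with hK
  have hsub : S ⊆ (Finset.Icc e₀ K).image (fun k ↦ p ^ k) := by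
    intro n hn
    simp only [hS, Finset.mem_filter, Finset.mem_Icc] at hn
    obtain ⟨⟨⟨-, hnN⟩, hpn, hPn⟩, hpp⟩ := hn
    obtain ⟨q, k, hq, hk, rfl⟩ := (isPrimePow_nat_iff _).mp hpp
    have hqp : p = q := (Nat.prime_dvd_prime_iff_eq hp hq).mp (hp.dvd_of_dvd_pow hpn)
    subst hqp
    refine Finset.mem_image.mpr ⟨k, Finset.mem_Icc.mpr ⟨hP k hk hPn, Nat.le_log_of_pow_le hp.one_lt hnN⟩, rfl⟩
  have hterm : ∀ k ∈ Finset.Icc e₀ K, (Λ (p ^ k) : ℝ) / (p ^ k : ℕ) = Real.log p * (1 / (p : ℝ)) ^ k := by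
    intro k hk
    rw [Finset.mem_Icc] at hk
    rw [vonMangoldt_apply_pow (by omega), vonMangoldt_apply_prime hp]
    push_cast
    rw [div_pow, one_pow, div_eq_mul_one_div]
  have hinj : Set.InjOn (fun k ↦ p ^ k) (Finset.Icc e₀ K : Set ℕ) :=
    fun a _ b _ hab ↦ Nat.pow_right_injective hp.two_le hab
  have hnonneg : ∀ d ∈ (Finset.Icc e₀ K).image (fun k ↦ p ^ k), 0 ≤ (Λ d : ℝ) / d :=
    fun d _ ↦ div_nonneg vonMangoldt_nonneg (Nat.cast_nonneg d)
  have hq : 1 / (p : ℝ) < 1 := by rw [div_lt_one hp0]; linarith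
  calc ∑ d ∈ (Finset.Icc 1 N).filter (fun d ↦ p ∣ d ∧ P d), (Λ d : ℝ) / d = ∑ d ∈ S, (Λ d : ℝ) / d := hsplit
    _ ≤ ∑ d ∈ (Finset.Icc e₀ K).image (fun k ↦ p ^ k), (Λ d : ℝ) / d :=
        Finset.sum_le_sum_of_subset_of_nonneg hsub fun d hd _ ↦ hnonneg d hd
    _ = ∑ k ∈ Finset.Icc e₀ K, (Λ (p ^ k) : ℝ) / (p ^ k : ℕ) := Finset.sum_image hinj
    _ = ∑ k ∈ Finset.Icc e₀ K, Real.log p * (1 / (p : ℝ)) ^ k := Finset.sum_congr rfl hterm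
    _ = Real.log p * ∑ k ∈ Finset.Ico e₀ (K + 1), (1 / (p : ℝ)) ^ k := by
        rw [← Finset.mul_sum, Finset.Ico_add_one_right_eq_Icc]
    _ ≤ Real.log p * ((1 / (p : ℝ)) ^ e₀ / (1 - 1 / p)) := by
        gcongr
        exact geom_sum_Ico_le_of_lt_one (by positivity) hq
    _ ≤ Real.log p * (2 * (1 / (p : ℝ)) ^ e₀) := by
        refine mul_le_mul_of_nonneg_left ?_ hlogp
        have h12 : 1 / (p : ℝ) ≤ 1 / 2 := one_div_le_one_div_of_le (by norm_num) hp2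
        have hpos : (0 : ℝ) < 1 - 1 / p := by linarith
        rw [div_le_iff₀ hpos]
        nlinarith [pow_nonneg (by positivity : (0 : ℝ) ≤ 1 / p) e₀]
    _ = 2 * Real.log p / (p : ℝ) ^ e₀ := by rw [one_div_pow]; ring

/-! ## `Σ Λ(n)/n` -/

/-- Pointwise domination: for `1 ≤ n ≤ N`, `Λ(n)/n ≤ Σ_{p ≤ N prime} [p ∣ n] Λ(n)/n` (a prime power
`n = q^e ≤ N` is divisible by the prime `q ≤ N`). [folklore] -/
theorem vonMangoldt_div_le_sum_primesLE {N n : ℕ} (hn : n ∈ Finset.Icc 1 N) (P : ℕ → Prop) [DecidablePred P] (hPn : P n) :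
    (Λ n : ℝ) / n ≤ ∑ p ∈ Nat.primesLE N, if p ∣ n ∧ P n then (Λ n : ℝ) / n else 0 := by
  by_cases h0 : (Λ n : ℝ) = 0
  · rw [h0, zero_div]
    exact Finset.sum_nonneg fun p _ ↦ by split_ifs <;> exact le_rfl
  · obtain ⟨q, k, hq, hk, rfl⟩ := (isPrimePow_nat_iff _).mp (vonMangoldt_ne_zero_iff.mp h0)
    have hqN : q ∈ Nat.primesLE N := by
      rw [Nat.mem_primesLE]
      refine ⟨le_trans ?_ (Finset.mem_Icc.1 hn).2, hq⟩
      calc q = q ^ 1 := (pow_one q).symm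
        _ ≤ q ^ k := Nat.pow_le_pow_right hq.pos hk
    refine le_trans ?_ (Finset.single_le_sum (f := fun p ↦ if p ∣ q ^ k ∧ P (q ^ k) then (Λ (q ^ k) : ℝ) / (q ^ k : ℕ) else 0)
      (fun p _ ↦ by split_ifs <;> first | exact le_rfl | exact div_nonneg vonMangoldt_nonneg (Nat.cast_nonneg _)) hqN)
    rw [if_pos ⟨dvd_pow_self q (by omega), hPn⟩]

/-- **`Σ_{n ≤ N} Λ(n)/n ≤ 2 log N + 2 log 4`** (Mertens' first theorem, upper half, crude form;
Rudnick–Sarnak 1996, (2.7)/(3.49)). [cite: RudnickSarnak1996, (3.49)] -/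
theorem sum_vonMangoldt_div_self_le (N : ℕ) :
    ∑ n ∈ Finset.Icc 1 N, (Λ n : ℝ) / n ≤ 2 * Real.log N + 2 * Real.log 4 := by
  classical
  calc ∑ n ∈ Finset.Icc 1 N, (Λ n : ℝ) / n
      ≤ ∑ n ∈ Finset.Icc 1 N, ∑ p ∈ Nat.primesLE N, (if p ∣ n ∧ True then (Λ n : ℝ) / n else 0) :=
        Finset.sum_le_sum fun n hn ↦ vonMangoldt_div_le_sum_primesLE hn (fun _ ↦ True) trivial
    _ = ∑ p ∈ Nat.primesLE N, ∑ n ∈ (Finset.Icc 1 N).filter (fun d ↦ p ∣ d ∧ True), (Λ n : ℝ) / n := by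
        rw [Finset.sum_comm]
        refine Finset.sum_congr rfl fun p _ ↦ ?_
        rw [Finset.sum_filter]
    _ ≤ ∑ p ∈ Nat.primesLE N, 2 * Real.log p / (p : ℝ) ^ 1 := by
        refine Finset.sum_le_sum fun p hp ↦ ?_
        exact sum_vonMangoldt_div_filter_pow_le (Nat.mem_primesLE.1 hp).2 N 1 le_rfl (fun _ ↦ True) (fun e he _ ↦ he)
    _ = 2 * ∑ p ∈ Nat.primesLE N, Real.log p / p := by
        rw [Finset.mul_sum]; refine Finset.sum_congr rfl fun p _ ↦ ?_; rw [pow_one]; ring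
    _ ≤ 2 * (Real.log N + Real.log 4) := by
        have := MertensBound.sum_log_div_prime_le N
        linarith
    _ = 2 * Real.log N + 2 * Real.log 4 := by ring

/-- `Σ_{n ≤ N} Λ(n)/n ≥ 0`. [folklore] -/
theorem sum_vonMangoldt_div_self_nonneg (N : ℕ) : 0 ≤ ∑ n ∈ Finset.Icc 1 N, (Λ n : ℝ) / n :=
  Finset.sum_nonneg fun n _ ↦ div_nonneg vonMangoldt_nonneg (Nat.cast_nonneg n)

/-! ## `Σ log² k/k²` and the proper prime powers -/

/-- `log 3 < 1.3863` (from `log 3 < log 4 = 2 log 2`). [folklore] -/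
theorem log_three_lt : Real.log 3 < 1.3863 := by
  have h : Real.log 3 < Real.log 4 := Real.log_lt_log (by norm_num) (by norm_num)
  have h4 : Real.log 4 = 2 * Real.log 2 := by
    rw [show (4 : ℝ) = 2 ^ 2 by norm_num, Real.log_pow]; norm_num
  have := Real.log_two_lt_d9
  linarith

/-- **`Σ_{2 ≤ k ≤ M} log² k/k² ≤ 3`** for every `M` (the terms `k = 2, 3` plus the tail bound
`Montgomery.sum_Ioc_logSq_div_sq_le` at `N = 3`). [folklore] -/
theorem sum_logSq_div_sq_le (M : ℕ) : ∑ k ∈ Finset.Icc 2 M, Real.log k ^ 2 / (k : ℝ) ^ 2 ≤ 3 := by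
  have hlog2 := Real.log_two_lt_d9
  have hlog2' := Real.log_two_gt_d9
  have hlog3 := log_three_lt
  have hlog3' : 0 ≤ Real.log 3 := Real.log_nonneg (by norm_num)
  have hnonneg : ∀ k : ℕ, 0 ≤ Real.log k ^ 2 / (k : ℝ) ^ 2 := fun k ↦ by positivity
  rcases lt_or_ge M 4 with hM | hM
  · -- `M ≤ 3`: at most the two terms `k = 2, 3`
    calc ∑ k ∈ Finset.Icc 2 M, Real.log k ^ 2 / (k : ℝ) ^ 2 ≤ ∑ k ∈ Finset.Icc (2 : ℕ) 3, Real.log k ^ 2 / (k : ℝ) ^ 2 :=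
          Finset.sum_le_sum_of_subset_of_nonneg (Finset.Icc_subset_Icc_right (by omega)) fun k _ _ ↦ hnonneg k
      _ = Real.log 2 ^ 2 / 4 + Real.log 3 ^ 2 / 9 := by
          rw [show Finset.Icc (2 : ℕ) 3 = {2, 3} by decide, Finset.sum_pair (by norm_num)]
          norm_num
      _ ≤ 3 := by nlinarith
  · have htail := Montgomery.sum_Ioc_logSq_div_sq_le (le_refl 3) M
    have hsplit : Finset.Icc 2 M = {2, 3} ∪ Finset.Ioc 3 M := by
      ext k; simp only [Finset.mem_Icc, Finset.mem_union, Finset.mem_insert, Finset.mem_singleton, Finset.mem_Ioc]; omega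
    have hdisj : Disjoint ({2, 3} : Finset ℕ) (Finset.Ioc 3 M) := by
      rw [Finset.disjoint_left]; intro k hk hk'
      simp only [Finset.mem_insert, Finset.mem_singleton] at hk
      rw [Finset.mem_Ioc] at hk'; omega
    rw [hsplit, Finset.sum_union hdisj, Finset.sum_pair (by norm_num)]
    push_cast at htail ⊢
    have h3 : (Real.log 3 ^ 2 + 2 * Real.log 3 + 2) / 3 ≤ 2.3 := by
      rw [div_le_iff₀ (by norm_num)]; nlinarith
    nlinarith

/-- `Σ_{n ≤ N} Λ(n)²/n² ≤ 3` (`Λ ≤ log`). [folklore] -/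
theorem sum_vonMangoldt_sq_div_sq_le (N : ℕ) : ∑ n ∈ Finset.Icc 1 N, (Λ n : ℝ) ^ 2 / (n : ℝ) ^ 2 ≤ 3 := by
  have h1 : ∑ n ∈ Finset.Icc 1 N, (Λ n : ℝ) ^ 2 / (n : ℝ) ^ 2 ≤ ∑ n ∈ Finset.Icc 1 N, Real.log n ^ 2 / (n : ℝ) ^ 2 := by
    refine Finset.sum_le_sum fun n _ ↦ div_le_div_of_nonneg_right ?_ (by positivity)
    exact pow_le_pow_left₀ vonMangoldt_nonneg vonMangoldt_le_log 2
  refine h1.trans ?_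
  rcases Nat.eq_zero_or_pos N with rfl | hN
  · simp
  rw [← Finset.sum_Ioc_add_eq_sum_Icc hN]
  simp only [Nat.cast_one, Real.log_one, ne_eq, OfNat.ofNat_ne_zero, not_false_eq_true, zero_pow, zero_div, add_zero]
  have : Finset.Ioc 1 N = Finset.Icc 2 N := by ext k; simp only [Finset.mem_Ioc, Finset.mem_Icc]; omega
  rw [this]
  exact sum_logSq_div_sq_le N

/-- **The proper prime powers are bounded**: `Σ_{n ≤ N, n not prime} Λ(n)/n ≤ 7`
(`Σ_p Σ_{e ≥ 2} log p/p^e ≤ Σ_p 2 log p/p² ≤ 2(log 2/4 + Σ_{p ≥ 3} log² p/p²)`; Rudnick–Sarnak 1996,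
Lemma 3.8: the prime powers `k ≥ 2` "contribute a bounded quantity"). [cite: RudnickSarnak1996, Lemma 3.8] -/
theorem sum_vonMangoldt_div_self_not_prime_le (N : ℕ) :
    ∑ n ∈ (Finset.Icc 1 N).filter (fun n ↦ ¬ n.Prime), (Λ n : ℝ) / n ≤ 7 := by
  classical
  have hstep1 : ∑ n ∈ (Finset.Icc 1 N).filter (fun n ↦ ¬ n.Prime), (Λ n : ℝ) / n ≤
      ∑ p ∈ Nat.primesLE N, 2 * Real.log p / (p : ℝ) ^ 2 := by
    calc ∑ n ∈ (Finset.Icc 1 N).filter (fun n ↦ ¬ n.Prime), (Λ n : ℝ) / n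
        ≤ ∑ n ∈ (Finset.Icc 1 N).filter (fun n ↦ ¬ n.Prime),
            ∑ p ∈ Nat.primesLE N, (if p ∣ n ∧ ¬ n.Prime then (Λ n : ℝ) / n else 0) := by
          refine Finset.sum_le_sum fun n hn ↦ ?_
          rw [Finset.mem_filter] at hn
          exact vonMangoldt_div_le_sum_primesLE hn.1 (fun n ↦ ¬ n.Prime) hn.2
      _ ≤ ∑ n ∈ Finset.Icc 1 N, ∑ p ∈ Nat.primesLE N, (if p ∣ n ∧ ¬ n.Prime then (Λ n : ℝ) / n else 0) :=
          Finset.sum_le_sum_of_subset_of_nonneg (Finset.filter_subset _ _) fun n _ _ ↦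
            Finset.sum_nonneg fun p _ ↦ by split_ifs <;> first | exact le_rfl | exact div_nonneg vonMangoldt_nonneg (Nat.cast_nonneg n)
      _ = ∑ p ∈ Nat.primesLE N, ∑ n ∈ (Finset.Icc 1 N).filter (fun d ↦ p ∣ d ∧ ¬ d.Prime), (Λ n : ℝ) / n := by
          rw [Finset.sum_comm]
          refine Finset.sum_congr rfl fun p _ ↦ ?_
          rw [Finset.sum_filter]
      _ ≤ ∑ p ∈ Nat.primesLE N, 2 * Real.log p / (p : ℝ) ^ 2 := by
          refine Finset.sum_le_sum fun p hp ↦ ?_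
          have hp' := (Nat.mem_primesLE.1 hp).2
          refine sum_vonMangoldt_div_filter_pow_le hp' N 2 (by norm_num) (fun d ↦ ¬ d.Prime) fun e he hne ↦ ?_
          by_contra h
          have : e = 1 := by omega
          subst this
          exact hne (by simpa using hp')
  refine hstep1.trans ?_
  -- `2 log p/p² ≤ 2 log² p/p²` for `p ≥ 3`; the prime `2` separately
  have hlog2 := Real.log_two_lt_d9
  have hterm : ∀ p ∈ Nat.primesLE N, 2 * Real.log p / (p : ℝ) ^ 2 ≤
      (if p = 2 then (1 / 2 : ℝ) else 0) + 2 * (Real.log p ^ 2 / (p : ℝ) ^ 2) := by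
    intro p hp
    have hp' := (Nat.mem_primesLE.1 hp).2
    by_cases h2 : p = 2
    · subst h2
      rw [if_pos rfl]
      push_cast
      have : 0 ≤ Real.log 2 ^ 2 / 2 ^ 2 := by positivity
      nlinarith
    · rw [if_neg h2, zero_add]
      have hp3 : (3 : ℝ) ≤ p := by
        have := hp'.two_le
        exact_mod_cast (show 3 ≤ p by omega)
      have hlog3 : 1 ≤ Real.log p := by
        rw [Real.le_log_iff_exp_le (by linarith)]
        have := Real.exp_one_lt_d9; linarith
      rw [mul_div_assoc]
      refine mul_le_mul_of_nonneg_left (div_le_div_of_nonneg_right ?_ (by positivity)) (by norm_num)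
      nlinarith
  calc ∑ p ∈ Nat.primesLE N, 2 * Real.log p / (p : ℝ) ^ 2
      ≤ ∑ p ∈ Nat.primesLE N, ((if p = 2 then (1 / 2 : ℝ) else 0) + 2 * (Real.log p ^ 2 / (p : ℝ) ^ 2)) :=
        Finset.sum_le_sum hterm
    _ = (∑ p ∈ Nat.primesLE N, if p = 2 then (1 / 2 : ℝ) else 0) + 2 * ∑ p ∈ Nat.primesLE N, Real.log p ^ 2 / (p : ℝ) ^ 2 := by
        rw [Finset.sum_add_distrib, Finset.mul_sum]
    _ ≤ 1 / 2 + 2 * ∑ k ∈ Finset.Icc 2 N, Real.log k ^ 2 / (k : ℝ) ^ 2 := by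
        refine add_le_add ?_ (mul_le_mul_of_nonneg_left ?_ (by norm_num))
        · rw [Finset.sum_ite_eq']; split_ifs <;> norm_num
        · refine Finset.sum_le_sum_of_subset_of_nonneg (fun p hp ↦ ?_) fun k _ _ ↦ by positivity
          obtain ⟨hpN, hp'⟩ := Nat.mem_primesLE.1 hp
          rw [Finset.mem_Icc]; exact ⟨hp'.two_le, hpN⟩
    _ ≤ 1 / 2 + 2 * 3 := by linarith [sum_logSq_div_sq_le N]
    _ ≤ 7 := by norm_num

/-! ## Higher moments -/

/-- `Σ_{n ≤ N} Λ(n)²/n ≤ log N (2 log N + 2 log 4)` (`Λ(n) ≤ log n ≤ log N`). [folklore] -/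
theorem sum_vonMangoldt_sq_div_self_le (N : ℕ) :
    ∑ n ∈ Finset.Icc 1 N, (Λ n : ℝ) ^ 2 / n ≤ Real.log N * (2 * Real.log N + 2 * Real.log 4) := by
  calc ∑ n ∈ Finset.Icc 1 N, (Λ n : ℝ) ^ 2 / n ≤ ∑ n ∈ Finset.Icc 1 N, Real.log N * ((Λ n : ℝ) / n) := by
        refine Finset.sum_le_sum fun n hn ↦ ?_
        obtain ⟨hn1, hnN⟩ := Finset.mem_Icc.1 hn
        rw [sq, mul_div_assoc]
        refine mul_le_mul_of_nonneg_right (vonMangoldt_le_log.trans ?_) (div_nonneg vonMangoldt_nonneg (Nat.cast_nonneg n))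
        exact Real.log_le_log (by exact_mod_cast hn1) (by exact_mod_cast hnN)
    _ = Real.log N * ∑ n ∈ Finset.Icc 1 N, (Λ n : ℝ) / n := by rw [Finset.mul_sum]
    _ ≤ Real.log N * (2 * Real.log N + 2 * Real.log 4) := by
        rcases Nat.eq_zero_or_pos N with rfl | hN
        · simp
        · exact mul_le_mul_of_nonneg_left (sum_vonMangoldt_div_self_le N)
            (Real.log_nonneg (by exact_mod_cast hN))

/-- `Σ_{n ≤ N} Λ(n)⁴/n² ≤ 3 log² N`. [folklore] -/
theorem sum_vonMangoldt_pow_four_div_sq_le (N : ℕ) :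
    ∑ n ∈ Finset.Icc 1 N, (Λ n : ℝ) ^ 4 / (n : ℝ) ^ 2 ≤ 3 * Real.log N ^ 2 := by
  calc ∑ n ∈ Finset.Icc 1 N, (Λ n : ℝ) ^ 4 / (n : ℝ) ^ 2
      ≤ ∑ n ∈ Finset.Icc 1 N, Real.log N ^ 2 * ((Λ n : ℝ) ^ 2 / (n : ℝ) ^ 2) := by
        refine Finset.sum_le_sum fun n hn ↦ ?_
        obtain ⟨hn1, hnN⟩ := Finset.mem_Icc.1 hn
        have hΛ : (Λ n : ℝ) ≤ Real.log N := vonMangoldt_le_log.trans (Real.log_le_log (by exact_mod_cast hn1) (by exact_mod_cast hnN))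
        have hΛ2 : (Λ n : ℝ) ^ 2 ≤ Real.log N ^ 2 := pow_le_pow_left₀ vonMangoldt_nonneg hΛ 2
        rw [show (Λ n : ℝ) ^ 4 = (Λ n : ℝ) ^ 2 * (Λ n : ℝ) ^ 2 by ring, mul_div_assoc]
        exact mul_le_mul_of_nonneg_right hΛ2 (by positivity)
    _ = Real.log N ^ 2 * ∑ n ∈ Finset.Icc 1 N, (Λ n : ℝ) ^ 2 / (n : ℝ) ^ 2 := by rw [Finset.mul_sum]
    _ ≤ Real.log N ^ 2 * 3 := mul_le_mul_of_nonneg_left (sum_vonMangoldt_sq_div_sq_le N) (by positivity)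
    _ = 3 * Real.log N ^ 2 := by ring

end RudnickSarnakN

end Literature.NumberTheory.LFunctions

end
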